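import Summits.HodgeConjecture.HodgeConjecture.Theorems.Ring2AbelianAllStandardAPencilsLowRungs
import Summits.HodgeConjecture.HodgeConjecture.Theorems.Ring2AbelianAllStandardAPencilsTransport
import Literature.AlgebraicGeometry.HodgeTheory.HolomorphicBundleChernCharacterTopDegree
import HarnessLib

/-!
# Ring 2 · §AbelianAll (seat `ab-andre-1`), XIV-d — Kleiman's `D(X) ⇒ A(X, L)` ON THE REAL CARRIERS, fact-free and
# ONE-SIDED: `A(X, η)` follows from "a numerically trivial algebraic class of codimension `q > n/2` is homologically
# trivial" (tested against the algebraic classes of codimension `n - q ≥ 2`); hence the `A`-nodes of part XIV from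
# `hom ≡ num` on the TOTAL SPACES of compact abelian pencils, and the first open `A`-rung `d = 4` from ONE vanishing
# statement for algebraic surface classes on fivefold total spaces

HONEST FRAMING: research route, not a corollary; conditional on HC_CM plus one named minimal statement.
(Cell line: research route conditional on HC_CM; not a corollary; Q11.4-sentence-2 already refuted in dim ≥ 3.)
Nothing in this file proves a case of the Hodge conjecture for an abelian variety, a case of `A(X)`, `B(X)` or `D(X)` in
an open range, or that any node is minimal. `HC_CM` = `Theses.RankFourFaces.CMAbelianHodge` and `HC_AV` =
`Theses.PadicSemiregularLift.HodgeAbelianVarieties` are BINDERS wherever they occur; item `Theses.RankFourFaces.CMToAbelian`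
(stmt-16267) stays OPEN. No definition, no named fact, no sorry: theorems only, over the tree's real carriers
`H•(X(ℂ); ℂ)`, `Nᵖ H²ᵖ = HodgeTheory.algebraicClasses`, `HodgeTheory.StandardConjectureA`.

## Why this file (the `A`-letter of part XIV, one node higher: `D`)

Part XIV put Grothendieck's `A(𝒳, η)` on the total spaces of compact abelian pencils (`CompactAbelianPencilStandardA` =
A_pen∀, `CMPointedPencilStandardA` = A_pen^CM) below André's `B(𝒳)`; part XIV-c proved the rungs `d ≤ 3` fact-free and
isolated the first open rung `d = 4` as one surjectivity `L_η : N²H⁴(𝒳) ↠ N³H⁶(𝒳)`. In characteristic `0`, `A(X, L)` is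
EQUIVALENT to Grothendieck's `D(X)` (numerical ≡ homological equivalence; Kleiman 1968 §3, Lieberman 1968), and `D` —
not `A` or `B` — is the form in which print speaks about the total spaces of abelian schemes over curves: S. Abdulali
1994 p. 1122 and J. Milne 2020 Prop. 1 (seat ab-andre-2, parts XVIII-a–c: the fibre-supported instance (Num) of
`D(𝒳)`), Y. André 2026 §4.4.1 ("conjecture D for the total space", preprint), and S. G. Tankeev, Izv. Math. 72:4 (2008)
817–844 [Tankeev2008], whose zbMATH review Zbl 1157.14002 reports (i) that the Hodge conjecture for some generic
geometric fibre of an abelian scheme `π : X → C` over a smooth projective curve implies the coincidence of numerical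
and homological equivalence on `X`, and (ii) that the Hodge conjecture for all complex abelian varieties is equivalent
to `B(X)` for all such `X` (TEXT NOT HELD — acquisition requested; neither statement is typed or used in the tree; they
are quoted here only to say which printed results the hypotheses below are shaped to receive). This file supplies the
KERNEL half of the edge `D(𝒳) ⟹ A(𝒳, η)`: Kleiman's Theorem 3.5, on the real carriers, in the sharpest one-sided form
the proof uses.

## What is proved

§1 (any smooth complex projective `X` of dimension `n`, any polarisation class `η`).
* `standardConjectureA_of_cupPairing_nondegenerate`: if for every `2 ≤ p`, `2p + r = n`, `0 < r`, `q = p + r`, every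
  `y ∈ N^q H^{2p+2r}(X(ℂ); ℂ)` with `x ∪ y = 0` for all `x ∈ Nᵖ H²ᵖ` is zero, then `A(X, η)`. Proof (Kleiman 1968,
  Thm. 3.5, linear algebra): `Lʳ` maps `Nᵖ` into `N^q` (Voisin II Prop. 9.20, tree) injectively (hard Lefschetz), so
  `dim Nᵖ ≤ dim N^q`; the hypothesis embeds `N^q` into `Hom(Nᵖ, H²ⁿ) ≅ (Nᵖ)^*` (`dim H²ⁿ = 1`), so `dim N^q ≤ dim Nᵖ`;
  hence `Lʳ(Nᵖ) = N^q`. The codimensions `p ≤ 1` need nothing (part XIV-c: Lefschetz `(1,1)`), nor does the middle one.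
* `standardConjectureA_of_homNum`: the same with the hypothesis in the symmetric spelling "for `p + q = n`, `2 ≤ p < q`:
  `y ∈ N^q H^{2q}`, `Nᵖ ∪ y = 0 ⟹ y = 0`" — `D(X) ⊗ ℂ` for the algebraic classes of codimension `q > n/2`, i.e. for
  cycles of dimension `< n/2`, tested against complementary algebraic classes (for the `ℂ`-spans of the cycle classes;
  the pairing and both spans are defined over `ℚ`, so this is the complexification of the statement on `ℚ`-cycles).
§2 (compact abelian pencils; total space `𝒳` of dimension `d + 1`).
* `standardACompactPencilsAtRelDim_of_homNum`, `standardACMPointedPencilsAtRelDim_of_homNum` (graded), and the nodes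
  `compactAbelianPencilStandardA_of_homNum` (A_pen∀), `cmPointedPencilStandardA_of_homNum` (A_pen^CM) from `hom ≡ num` in
  the above range on the total spaces of all (resp. the CM-pointed) compact abelian pencils.
* The cell rows through `D`: `HC_AV_of_abdulaliA_of_andre1996_of_HC_CM_of_homNumCMPointed`
  (`h₈A → h₂₁ → HC_CM → [hom ≡ num on CM-pointed total spaces] → HC_AV`) and
  `HC_AV_and_HC_CM_of_abdulaliA_of_andre1996_of_homNumCompact` (`h₈A → h₂₁ → h₂₂ → [hom ≡ num on all compact total
  spaces] → HC_AV ∧ HC_CM`), by part XIV-b.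
* `standardACompactPencilsAtRelDim_four_of_homNum_surfaces`: the first open `A`-rung `(A∀)_4` follows from ONE
  statement per compact pencil of abelian fourfolds: an algebraic SURFACE class `y ∈ N³ H⁶(𝒳(ℂ); ℂ)` on the fivefold
  `𝒳` with `x ∪ y = 0` for every algebraic codimension-`2` class `x` is zero; and its CM-pointed twin.

## What is NOT claimed

No instance of the hypotheses is proved here (for `dim X ≤ 4` they are not needed: part XIV-c); the converse
`A(X, η) ⟹ hom ≡ num` (Hodge index; seat ab-andre-2, part XVIII-d, pending) is not restated; Tankeev's theorems are
not typed (texts wanted: Zbl 1157.14002, Zbl 1075.14004); nothing is claimed minimal; `HC_CM`, `h₈A`, `h₂₁`, `h₂₂`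
are binders / named facts exactly as in parts XIV, XIV-b.

## References

* [Kleiman1968AlgebraicCycles] S. Kleiman, Algebraic cycles and the Weil conjectures, in: Dix exposés sur la
  cohomologie des schémas (1968), §3 Thm. 3.5 (`D(X) ⇒ A(X, L)`), Prop. 3.6.
* [Kleiman1994StandardConjectures] S. Kleiman, The standard conjectures, PSPM 55.1 (1994), §§4–5.
* [Grothendieck1968] A. Grothendieck, Standard conjectures on algebraic cycles (Bombay 1968), §3 p. 196 (`A(X)`, `D(X)`).
* [Lieberman1968] D. I. Lieberman, Numerical and homological equivalence of algebraic cycles on Hodge manifolds,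
  Amer. J. Math. 90 (1968).
* [VoisinHodgeII2003] C. Voisin, Hodge Theory and Complex Algebraic Geometry II, §9.2.4 Prop. 9.20.
* [Abdulali1994FamiliesAV] S. Abdulali, Canad. J. Math. 46 (1994), p. 1122. [Milne2020HodgeClassesAV] J. S. Milne,
  Hodge classes on abelian varieties (2020), Prop. 1 (p. 7). [Andre1996Motifs] Y. André, Publ. Math. IHÉS 83 (1996),
  §6.3. Y. André, arXiv:2601.21052 (2026, preprint), §4.4.1.
* [Tankeev2008] S. G. Tankeev, On algebraic cycles on complex abelian schemes over smooth projective curves, Izv.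
  Math. 72:4 (2008) 817–844 (Zbl 1157.14002) — print-reported, text not held, NOT used.
-/

noncomputable section

set_option linter.dupNamespace false

namespace Summit.HodgeConjecture.HodgeConjecture.Ring2.AbelianAll

open CategoryTheory AlgebraicGeometry
open Literature.AlgebraicGeometry Literature.AlgebraicGeometry.Motives
open Literature.AlgebraicGeometry.HodgeTheory
open Literature.AlgebraicTopology.SingularHomology Literature.Geometry.Kaehler
open Literature.AlgebraicGeometry.Deligne1982 (cmLocus)
open Literature.AlgebraicGeometry.Abdulali1994 (Abdulali1994_invariantCycles_of_lefschetzStandardA)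
open Literature.AlgebraicGeometry.Andre1996 (andre1996_cmAnchoredPencil andre1996_cmHodgeClasses_algebraicallyAnchoredPencils)
open Summit.HodgeConjecture.HodgeConjecture
open Summit.HodgeConjecture.HodgeConjecture.Theses

/-! ## §1 Kleiman's Theorem 3.5 on the real carriers: `A(X, η)` from one-sided `hom ≡ num` above the middle -/

section RealCarriers

variable {n : ℕ} {X : SchemeOver ℂ} {η : complexBetti X 2}

/-- **`D ⇒ A` on the real carriers, one-sided (Kleiman 1968, Thm. 3.5).** Let `X` be smooth complex projective of
dimension `n` and `η` a polarisation class. Suppose that for every `2 ≤ p`, `2p + r = n`, `0 < r`, `q = p + r`, an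
element `y` of `N^q H^{2p+2r}(X(ℂ); ℂ)` (the `ℂ`-span of the classes of the algebraic cycles of dimension `p < n/2`) whose
cup product with every algebraic class of codimension `p` vanishes is zero. Then `A(X, η)` holds. Linear algebra:
`Lʳ(Nᵖ) ⊆ N^q` with `Lʳ` injective gives `dim Nᵖ ≤ dim N^q`; the hypothesis embeds `N^q` in `Hom_ℂ(Nᵖ, H²ⁿ)`, of
dimension `dim Nᵖ · 1`; so `Lʳ(Nᵖ) = N^q`. The codimensions `p ≤ 1` and the middle are unconditional (part XIV-c).
[cite: Kleiman1968AlgebraicCycles, §3 Thm. 3.5] [cite: Grothendieck1968, §3 p. 196 (A(X), D(X))]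
[cite: VoisinHodgeII2003, §9.2.4 Prop. 9.20] -/
theorem standardConjectureA_of_cupPairing_nondegenerate (hX : IsSmoothProjective n X)
    (hη : IsPolarizationClass n X η)
    (hD : ∀ (p r q : ℕ) (_ : 2 ≤ p) (hpr : 2 * p + r = n) (_ : p + r = q) (_ : 0 < r),
      ∀ y ∈ supportedClasses X (2 * p + 2 * r) q,
        (∀ x ∈ algebraicClasses X p, cupProduct (show 2 * p + (2 * p + 2 * r) = 2 * n by omega) x y = 0) →
          y = 0) :
    StandardConjectureA n X η := by
  refine standardConjectureA_of_surjOn_two_le hX hη fun p r q hp hpr hq hr ↦ ?_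
  haveI := finite_complexBetti hX (2 * p)
  haveI := finite_complexBetti hX (2 * p + 2 * r)
  haveI := finite_complexBetti hX (2 * n)
  -- (i) `Lʳ(Nᵖ) ⊆ N^q`
  have hmap : (algebraicClasses X p).map (lefschetzPow η r (2 * p)) ≤ supportedClasses X (2 * p + 2 * r) q := by
    rintro _ ⟨x, hx, rfl⟩
    exact lefschetzPow_mapsTo_algebraicClasses hX hη.mem_algebraicClasses hq hx
  -- (ii) `dim Lʳ(Nᵖ) = dim Nᵖ` (hard Lefschetz: `Lʳ` is injective on all of `H²ᵖ`)
  have hinj : Function.Injective (lefschetzPow η r (2 * p)) := (hη.hasHardLefschetz r (2 * p) hpr).1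
  have h₁ : Module.finrank ℂ (algebraicClasses X p) =
      Module.finrank ℂ ((algebraicClasses X p).map (lefschetzPow η r (2 * p))) :=
    (Submodule.equivMapOfInjective _ hinj _).finrank_eq
  -- (iii) `dim N^q ≤ dim Nᵖ`: `y ↦ (x ↦ x ∪ y)` embeds `N^q` into `Hom(Nᵖ, H²ⁿ)`, and `dim H²ⁿ = 1`
  have h2n : Module.finrank ℂ (complexBetti X (2 * n)) = 1 := finrank_complexBetti_two_mul_eq_one hX
  let B := cupProduct (R := ℂ) (X := ComplexPoints X) (show 2 * p + (2 * p + 2 * r) = 2 * n by omega)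
  let Φ : supportedClasses X (2 * p + 2 * r) q →ₗ[ℂ] (algebraicClasses X p →ₗ[ℂ] complexBetti X (2 * n)) :=
    (B.domRestrict₁₂ (algebraicClasses X p) (supportedClasses X (2 * p + 2 * r) q)).flip
  have hΦ : Function.Injective Φ := by
    rw [← LinearMap.ker_eq_bot, LinearMap.ker_eq_bot']
    intro y hy
    have hy0 : (y : complexBetti X (2 * p + 2 * r)) = 0 :=
      hD p r q hp hpr hq hr y y.2 fun x hx ↦ by
        have h := LinearMap.congr_fun hy ⟨x, hx⟩
        simp only [Φ, B, LinearMap.flip_apply, LinearMap.domRestrict₁₂_apply, LinearMap.zero_apply] at h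
        exact h
    exact Subtype.ext hy0
  have h₂ : Module.finrank ℂ (supportedClasses X (2 * p + 2 * r) q) ≤ Module.finrank ℂ (algebraicClasses X p) := by
    have h := LinearMap.finrank_le_finrank_of_injective hΦ
    rwa [Module.finrank_linearMap, h2n, mul_one] at h
  -- (iv) so `Lʳ(Nᵖ) = N^q`, which is the surjectivity asked
  have heq : (algebraicClasses X p).map (lefschetzPow η r (2 * p)) = supportedClasses X (2 * p + 2 * r) q :=
    Submodule.eq_of_le_of_finrank_le hmap (h₂.trans h₁.le)
  intro y hy
  rw [← heq] at hy
  obtain ⟨x, hx, rfl⟩ := hy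
  exact ⟨x, hx, rfl⟩

/-- **`A(X, η)` from `hom ≡ num ⊗ ℂ` for the algebraic classes of codimension `q > n/2`, symmetric spelling**: if for all
`p + q = n` with `2 ≤ p < q` every `y ∈ N^q H^{2q}(X(ℂ); ℂ)` with `x ∪ y = 0` for all `x ∈ Nᵖ H²ᵖ(X(ℂ); ℂ)` is zero, then
`A(X, η)` for every polarisation class `η` (`standardConjectureA_of_cupPairing_nondegenerate`, degrees transported).
This is the complexification of Grothendieck's `D(X)` restricted to cycles of dimension `< n/2` (and to `p ≥ 2`).
[cite: Kleiman1968AlgebraicCycles, §3 Thm. 3.5] [cite: Grothendieck1968, §3 p. 196 (A(X), D(X))] -/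
theorem standardConjectureA_of_homNum (hX : IsSmoothProjective n X) (hη : IsPolarizationClass n X η)
    (hD : ∀ (p q : ℕ) (hpq : p + q = n) (_ : 2 ≤ p) (_ : p < q),
      ∀ y ∈ algebraicClasses X q,
        (∀ x ∈ algebraicClasses X p, cupProduct (show 2 * p + 2 * q = 2 * n by omega) x y = 0) → y = 0) :
    StandardConjectureA n X η := by
  refine standardConjectureA_of_cupPairing_nondegenerate hX hη fun p r q hp hpr hq hr ↦ ?_
  have key : ∀ (i : ℕ) (hi : 2 * q = i), ∀ y ∈ supportedClasses X i q,
      (∀ x ∈ algebraicClasses X p, cupProduct (show 2 * p + i = 2 * n by omega) x y = 0) → y = 0 := by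
    rintro _ rfl y hy h
    exact hD p q (by omega) hp (by omega) y hy h
  exact key (2 * p + 2 * r) (by omega)

/-- **Dimension `5`, the first case with content**: for a smooth complex projective FIVEFOLD and a polarisation class,
`A(X, η)` follows from the single statement "an element of `N³ H⁶(X(ℂ); ℂ)` (span of the algebraic surface classes)
orthogonal under cup product to `N² H⁴(X(ℂ); ℂ)` is zero" (the instance `(p, q) = (2, 3)`; all others are
unconditional, part XIV-c `standardConjectureA_five_iff_surjOn`). [cite: Kleiman1968AlgebraicCycles, §3 Thm. 3.5]
[cite: Grothendieck1968, §3 p. 196 (A(X))] -/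
theorem standardConjectureA_five_of_homNum_surfaces (hX : IsSmoothProjective 5 X) (hη : IsPolarizationClass 5 X η)
    (hD : ∀ y ∈ algebraicClasses X 3,
      (∀ x ∈ algebraicClasses X 2, cupProduct (show 2 * 2 + 2 * 3 = 2 * 5 by omega) x y = 0) → y = 0) :
    StandardConjectureA 5 X η := by
  refine standardConjectureA_of_homNum hX hη fun p q hpq hp hlt ↦ ?_
  obtain rfl : p = 2 := by omega
  obtain rfl : q = 3 := by omega
  exact hD

end RealCarriers

/-! ## §2 The `A`-nodes of part XIV from `hom ≡ num` on the total spaces of compact abelian pencils -/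

/-- **`(A∀)_d` from `hom ≡ num` (codimension `q > (d+1)/2`, tested against codimension `p ≥ 2`) on the total space of
every compact pencil of abelian `d`-folds.** [cite: Kleiman1968AlgebraicCycles, §3 Thm. 3.5]
[cite: Andre1996Motifs, §6.3 Remarque 2 (p. 33)] -/
theorem standardACompactPencilsAtRelDim_of_homNum {d : ℕ}
    (hD : ∀ ⦃𝒳 S : SchemeOver ℂ⦄ (f : 𝒳 ⟶ S), IsCompactAbelianPencil f d →
      ∀ (p q : ℕ) (hpq : p + q = d + 1) (_ : 2 ≤ p) (_ : p < q), ∀ y ∈ algebraicClasses 𝒳 q,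
        (∀ x ∈ algebraicClasses 𝒳 p, cupProduct (show 2 * p + 2 * q = 2 * (d + 1) by omega) x y = 0) → y = 0) :
    StandardACompactPencilsAtRelDim d :=
  fun _ _ f hf _ hη ↦ standardConjectureA_of_homNum hf.isSmoothProjective_total hη (hD f hf)

/-- **`(A^CM)_d` from `hom ≡ num` on the total spaces of the CM-pointed compact pencils of abelian `d`-folds only.**
[cite: Kleiman1968AlgebraicCycles, §3 Thm. 3.5] [cite: Andre1996Motifs, Lemme 6.3.1 (ii) (p. 31)] -/
theorem standardACMPointedPencilsAtRelDim_of_homNum {d : ℕ}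
    (hD : ∀ ⦃𝒳 S : SchemeOver ℂ⦄ (f : 𝒳 ⟶ S), IsCompactAbelianPencil f d → (cmLocus f d).Nonempty →
      ∀ (p q : ℕ) (hpq : p + q = d + 1) (_ : 2 ≤ p) (_ : p < q), ∀ y ∈ algebraicClasses 𝒳 q,
        (∀ x ∈ algebraicClasses 𝒳 p, cupProduct (show 2 * p + 2 * q = 2 * (d + 1) by omega) x y = 0) → y = 0) :
    StandardACMPointedPencilsAtRelDim d :=
  fun _ _ f hf hCM _ hη ↦ standardConjectureA_of_homNum hf.isSmoothProjective_total hη (hD f hf hCM)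

/-- **A_pen∀ from `hom ≡ num` on the total spaces of all compact abelian pencils** — the kernel half of the printed edge
"Hodge conjecture for a generic geometric fibre ⟹ `num = hom` on the total space ⟹ `A`" (the first implication is
Tankeev 2008 as reported by Zbl 1157.14002, NOT typed; the second is this theorem). [cite: Kleiman1968AlgebraicCycles, §3 Thm. 3.5]
[cite: Andre1996Motifs, §6.3 Remarque 2 (p. 33)] -/
theorem compactAbelianPencilStandardA_of_homNum
    (hD : ∀ ⦃d : ℕ⦄ ⦃𝒳 S : SchemeOver ℂ⦄ (f : 𝒳 ⟶ S), IsCompactAbelianPencil f d →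
      ∀ (p q : ℕ) (hpq : p + q = d + 1) (_ : 2 ≤ p) (_ : p < q), ∀ y ∈ algebraicClasses 𝒳 q,
        (∀ x ∈ algebraicClasses 𝒳 p, cupProduct (show 2 * p + 2 * q = 2 * (d + 1) by omega) x y = 0) → y = 0) :
    CompactAbelianPencilStandardA :=
  fun _ _ _ f hf _ hη ↦ standardConjectureA_of_homNum hf.isSmoothProjective_total hη (hD f hf)

/-- **A_pen^CM from `hom ≡ num` on the total spaces of the CM-pointed compact abelian pencils.**
[cite: Kleiman1968AlgebraicCycles, §3 Thm. 3.5] [cite: Andre1996Motifs, Lemme 6.3.1 (ii) (p. 31)] -/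
theorem cmPointedPencilStandardA_of_homNum
    (hD : ∀ ⦃d : ℕ⦄ ⦃𝒳 S : SchemeOver ℂ⦄ (f : 𝒳 ⟶ S), IsCompactAbelianPencil f d → (cmLocus f d).Nonempty →
      ∀ (p q : ℕ) (hpq : p + q = d + 1) (_ : 2 ≤ p) (_ : p < q), ∀ y ∈ algebraicClasses 𝒳 q,
        (∀ x ∈ algebraicClasses 𝒳 p, cupProduct (show 2 * p + 2 * q = 2 * (d + 1) by omega) x y = 0) → y = 0) :
    CMPointedPencilStandardA :=
  cmPointedPencilStandardA_iff_forall.2 fun _ ↦ standardACMPointedPencilsAtRelDim_of_homNum fun _ _ f hf hCM ↦ hD f hf hCM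

/-- **The cell row through `D` on CM-pointed total spaces**: `h₈A → h₂₁ → HC_CM → [hom ≡ num on the total spaces of
the CM-pointed compact abelian pencils, codimension q > (d+1)/2 against p ≥ 2] → HC_AV` (part XIV-b's
`HC_AV_of_abdulaliA_of_andre1996_of_HC_CM_of_cmPointedPencilStandardA`). `HC_CM`, `h₈A`, `h₂₁` are BINDERS / named facts.
research route, not a corollary; conditional on HC_CM plus one named minimal statement.
[cite: Andre1996Motifs, Lemme 6.3.1 (p. 31) and §6.3 (p. 33)] [cite: Abdulali1994FamiliesAV, p. 1122]
[cite: Kleiman1968AlgebraicCycles, §3 Thm. 3.5] -/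
theorem HC_AV_of_abdulaliA_of_andre1996_of_HC_CM_of_homNumCMPointed
    (h₈A : Abdulali1994_invariantCycles_of_lefschetzStandardA) (h₂₁ : andre1996_cmAnchoredPencil)
    (hCM : RankFourFaces.CMAbelianHodge)
    (hD : ∀ ⦃d : ℕ⦄ ⦃𝒳 S : SchemeOver ℂ⦄ (f : 𝒳 ⟶ S), IsCompactAbelianPencil f d → (cmLocus f d).Nonempty →
      ∀ (p q : ℕ) (hpq : p + q = d + 1) (_ : 2 ≤ p) (_ : p < q), ∀ y ∈ algebraicClasses 𝒳 q,
        (∀ x ∈ algebraicClasses 𝒳 p, cupProduct (show 2 * p + 2 * q = 2 * (d + 1) by omega) x y = 0) → y = 0) :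
    PadicSemiregularLift.HodgeAbelianVarieties :=
  HC_AV_of_abdulaliA_of_andre1996_of_HC_CM_of_cmPointedPencilStandardA h₈A h₂₁ hCM (cmPointedPencilStandardA_of_homNum hD)

/-- **The cell row through `D` on all compact total spaces**: `h₈A → h₂₁ → h₂₂ → [hom ≡ num on the total spaces of all
compact abelian pencils, same range] → HC_AV ∧ HC_CM` (part XIV-b's
`HC_AV_and_HC_CM_of_abdulaliA_of_andre1996_of_compactAbelianPencilStandardA`). Named facts as binders; no case of HC proved.
[cite: Andre1996Motifs, Lemme 6.3.1 (p. 31) and §6.3 (p. 33)] [cite: Abdulali1994FamiliesAV, p. 1122]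
[cite: Kleiman1968AlgebraicCycles, §3 Thm. 3.5] -/
theorem HC_AV_and_HC_CM_of_abdulaliA_of_andre1996_of_homNumCompact
    (h₈A : Abdulali1994_invariantCycles_of_lefschetzStandardA) (h₂₁ : andre1996_cmAnchoredPencil)
    (h₂₂ : andre1996_cmHodgeClasses_algebraicallyAnchoredPencils)
    (hD : ∀ ⦃d : ℕ⦄ ⦃𝒳 S : SchemeOver ℂ⦄ (f : 𝒳 ⟶ S), IsCompactAbelianPencil f d →
      ∀ (p q : ℕ) (hpq : p + q = d + 1) (_ : 2 ≤ p) (_ : p < q), ∀ y ∈ algebraicClasses 𝒳 q,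
        (∀ x ∈ algebraicClasses 𝒳 p, cupProduct (show 2 * p + 2 * q = 2 * (d + 1) by omega) x y = 0) → y = 0) :
    PadicSemiregularLift.HodgeAbelianVarieties ∧ RankFourFaces.CMAbelianHodge :=
  HC_AV_and_HC_CM_of_abdulaliA_of_andre1996_of_compactAbelianPencilStandardA h₈A h₂₁ h₂₂
    (compactAbelianPencilStandardA_of_homNum hD)

/-! ## §3 The first open `A`-rung `d = 4` from one vanishing statement for algebraic surface classes -/

/-- **`(A∀)_4` from ONE statement per compact pencil of abelian FOURFOLDS**: on the fivefold total space `𝒳`, every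
element of `N³ H⁶(𝒳(ℂ); ℂ)` (span of the algebraic surface classes) orthogonal under cup product to `N² H⁴(𝒳(ℂ); ℂ)` is
zero. Compare part XIV-c `standardACompactPencilsAtRelDim_four_iff_surjOn` (the same rung as one surjectivity).
OPEN; stated as an implication, nothing asserted. [cite: Kleiman1968AlgebraicCycles, §3 Thm. 3.5]
[cite: Andre1996Motifs, §6.3 Remarque 2 (p. 33)] -/
theorem standardACompactPencilsAtRelDim_four_of_homNum_surfaces
    (hD : ∀ ⦃𝒳 S : SchemeOver ℂ⦄ (f : 𝒳 ⟶ S), IsCompactAbelianPencil f 4 →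
      ∀ y ∈ algebraicClasses 𝒳 3,
        (∀ x ∈ algebraicClasses 𝒳 2, cupProduct (show 2 * 2 + 2 * 3 = 2 * 5 by omega) x y = 0) → y = 0) :
    StandardACompactPencilsAtRelDim 4 :=
  fun _ _ f hf _ hη ↦ standardConjectureA_five_of_homNum_surfaces hf.isSmoothProjective_total hη (hD f hf)

/-- **`(A^CM)_4` from the same statement on the CM-pointed compact pencils of abelian fourfolds only** (the relative
dimension where Weil-type CM fibres first occur). [cite: Kleiman1968AlgebraicCycles, §3 Thm. 3.5]
[cite: Andre1996Motifs, Lemme 6.3.1 (ii) (p. 31)] -/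
theorem standardACMPointedPencilsAtRelDim_four_of_homNum_surfaces
    (hD : ∀ ⦃𝒳 S : SchemeOver ℂ⦄ (f : 𝒳 ⟶ S), IsCompactAbelianPencil f 4 → (cmLocus f 4).Nonempty →
      ∀ y ∈ algebraicClasses 𝒳 3,
        (∀ x ∈ algebraicClasses 𝒳 2, cupProduct (show 2 * 2 + 2 * 3 = 2 * 5 by omega) x y = 0) → y = 0) :
    StandardACMPointedPencilsAtRelDim 4 :=
  fun _ _ f hf hCM _ hη ↦ standardConjectureA_five_of_homNum_surfaces hf.isSmoothProjective_total hη (hD f hf hCM)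

end Summit.HodgeConjecture.HodgeConjecture.Ring2.AbelianAll

end
-- buildfix (ops-buildfix lane, 2026-08-20): comment-only re-land to enqueue the hub build after the Milne1999/CM chain repair (LEDGER C-7); no declaration changed.
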